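import Summits.ResolutionOfSingularities.ResolutionOfSingularities.Theorems.EquisingularLiftEquisingularLiftNatJunctionCuspIdeal
import Literature.AlgebraicGeometry.Resolution.NormalizationAsBlowup
import HarnessLib

/-!
# Junction lemma J2 (cuspidal transversal type), part 2: blowing up `Σ ∪ R` on `{v² = u³} × 𝔸¹` resolves in one step

[OURS · L1 W4.5(b)] Helper for the research stub `stub_elnat_three` of the crux `EquisingularLiftNat`
(stmt-ResolutionOfSingularities-20038; route `EquisingularLift`, chain w45b, CRUX-PLAN v3 §1.6 «NO-DAMAGE
(J2)» / §4 `junction_cusp_resolves`). NOT a statement of any manuscript; AI-written kernel lemma of the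
cell `res-hironaka` (weaker than expert review). It is the second of the two basic local models behind
the «single-sheet companion» lever of the line `sections`: a companion curve `R ⊂ H` meeting the double
curve `Σ ⊆ Sing H` inside ONE local sheet of `H` does no damage when `X = Σ ∪ R` is blown up.

**The model** (as in part 1, `…NatJunctionCuspIdeal.lean`). `k` a field; `H = {v² = u³} × 𝔸¹_w`
with coordinate ring `k[s², s³, w] = φ.range ⊆ k[s, w]`, `φ : (u, v, w) ↦ (s², s³, w)`; `Σ = {u = v = 0}`;
`R = {u = w², v = w³} ⊂ H`; `X = Σ ∪ R`; `I = I_X · 𝒪_H = (s³ − s²w, s⁴ − s²w²)` (part 1,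
`map_rangeRestrict_junctionIdeal`).

**Proved here:**
* `nonempty_algEquiv_away_traceIdeal` — the chart ring of `D₊((s³ − s²w)t)` in
  `Bl_I(H) = Proj 𝒪_H[It]` is `𝒪_H[I/(s³ − s²w)] = k[s², s³, w][s + w] = k[s, w]`, as `𝒪_H`-algebras;
* `junction_cusp_resolves` — **`Bl_X H = Bl_I(Spec k[s²,s³,w]) ≅ 𝔸²_{s,w} = Spec k[s, w]` over `H`**:
  the blow-up of `H` along `X` IS the normalisation, in particular regular — the single-sheet cuspidal
  junction is «RESOLVED in one step (`Bl_Σ H` also smooth here)» (CRUX-PLAN v3 §1.6 (J2)), no damage.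

Method: the tree's `NormalizationAsBlowup.lean` (one-chart criterion `basicOpen_reesT_eq_top_of_sq` fed
by part 1's `traceIdeal_sq`, `isIso_chartι_of_basicOpen_eq_top`) and the image model `R[I/c] ⊆ R[1/c]`
of the affine blowup algebra (`AffineBlowupAlgebra.lean`, Stacks 052Q/07Z3), mapped into `Frac k[s, w]`,
where its image is generated over `𝒪_H` by `s = (s⁴ − s³w)/(s³ − s²w)`.
What is NOT here: the power-series (complete local) version (flat base change); the companion lemma J1
(transversal `A₁` type) is a separate file.

References: Q. Liu, *Algebraic Geometry and Arithmetic Curves* (2002), Prop. 8.1.24 (a finite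
birational morphism is a blowing up) [Liu2002]; The Stacks Project, Tags 052Q, 07Z3, 0804 [StacksProject].
-/

-- single-problem summit: the doubled namespace component `ResolutionOfSingularities` is forced
set_option linter.dupNamespace false

noncomputable section

open MvPolynomial

namespace Summit.ResolutionOfSingularities.ResolutionOfSingularities.Theorems.EquisingularLift.Junction

universe u

section CuspModel

variable {k : Type u} [Field k]

/-! ### The blow-up of `H` along `X` is the normalisation `𝔸²_{s,w} → H` -/

set_option maxHeartbeats 400000 in
open CategoryTheory AlgebraicGeometry Literature.AlgebraicGeometry.Resolution HomogeneousLocalization in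
/-- **The chart ring of `D₊((s³ − s²w) t)` is `k[s, w]`.** For the trace ideal `I` of the junction
`X` on `H = Spec k[s², s³, w]` and its generator `c = s³ − s²w`:
`(k[s²,s³,w][It])_{(ct)} ≅ k[s²,s³,w][I/c] = k[s²,s³,w][s + w] = k[s, w]`, compatibly with the structure
maps. [folklore] -/
theorem nonempty_algEquiv_away_traceIdeal (φ : MvPolynomial (Fin 3) k →ₐ[k] MvPolynomial (Fin 2) k)
    (hφ : φ = aeval ![X 0 ^ 2, X 0 ^ 3, X 1]) (I : Ideal φ.range)
    (hI : I = Ideal.span {φ.rangeRestrict (X 1 - X 0 * X 2), φ.rangeRestrict (X 0 * (X 0 - X 2 ^ 2))})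
    (c : φ.range) (hc : c = φ.rangeRestrict (X 1 - X 0 * X 2)) (hcI : c ∈ I) :
    letI := (reesChartBase (I := I) c hcI).toAlgebra
    Nonempty (Away (reesGrading I) (reesT c hcI) ≃ₐ[φ.range] MvPolynomial (Fin 2) k) := by
  letI := (reesChartBase (I := I) c hcI).toAlgebra
  have hmem := mem_traceIdeal_iff φ hφ I hI
  obtain ⟨ha, -, has⟩ := cuspParam_gens φ hφ
  have hcB : (c : MvPolynomial (Fin 2) k) = X 0 ^ 3 - X 0 ^ 2 * X 1 := by
    rw [hc, coe_rangeRestrict_apply, ha]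
  -- `c s ∈ I`
  have hcs : φ.rangeRestrict (X 0 ^ 2 - X 1 * X 2) ∈ I :=
    (hmem _).mpr ⟨X 0, by rw [coe_rangeRestrict_apply, has]⟩
  have hinjRB : Function.Injective (algebraMap φ.range (MvPolynomial (Fin 2) k)) :=
    Subtype.val_injective
  have hinjBK : Function.Injective
      (algebraMap (MvPolynomial (Fin 2) k) (FractionRing (MvPolynomial (Fin 2) k))) :=
    IsFractionRing.injective _ _
  have hRK : ∀ x : φ.range, algebraMap φ.range (FractionRing (MvPolynomial (Fin 2) k)) x =
      algebraMap (MvPolynomial (Fin 2) k) (FractionRing (MvPolynomial (Fin 2) k)) x := fun x =>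
    IsScalarTower.algebraMap_apply φ.range (MvPolynomial (Fin 2) k) _ x
  have hinj : Function.Injective (algebraMap φ.range (FractionRing (MvPolynomial (Fin 2) k))) := by
    rw [IsScalarTower.algebraMap_eq φ.range (MvPolynomial (Fin 2) k) (FractionRing (MvPolynomial (Fin 2) k))]
    exact hinjBK.comp hinjRB
  have hc0 : c ≠ 0 := by
    intro h
    have : (c : MvPolynomial (Fin 2) k) = 0 := by rw [h]; rfl
    exact gen_ne_zero (hcB ▸ this)
  have hc0K : algebraMap φ.range (FractionRing (MvPolynomial (Fin 2) k)) c ≠ 0 := fun h =>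
    hc0 (hinj (by rw [h, map_zero]))
  have hcK : algebraMap (MvPolynomial (Fin 2) k) (FractionRing (MvPolynomial (Fin 2) k))
      (X 0 ^ 3 - X 0 ^ 2 * X 1) ≠ 0 := by rw [← hcB, ← hRK]; exact hc0K
  -- `R[1/c] → K`
  have hunit : ∀ y : Submonoid.powers c,
      IsUnit (Algebra.ofId φ.range (FractionRing (MvPolynomial (Fin 2) k)) y) := by
    rintro ⟨y, n, rfl⟩
    exact isUnit_iff_ne_zero.mpr (by
      rw [Algebra.ofId_apply, map_pow]
      exact pow_ne_zero _ hc0K)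
  let ψ : Localization.Away c →ₐ[φ.range] FractionRing (MvPolynomial (Fin 2) k) :=
    IsLocalization.liftAlgHom (M := Submonoid.powers c) (f := Algebra.ofId φ.range _) hunit
  have hψinj : Function.Injective ψ := by
    rw [IsLocalization.coe_liftAlgHom, IsLocalization.lift_injective_iff]
    intro x y
    constructor
    · intro h
      exact congrArg _ (IsLocalization.injective (Localization.Away c)
        (powers_le_nonZeroDivisors_of_noZeroDivisors hc0) h)
    · intro h
      exact congrArg _ (hinj h)
  have hψc : ψ (IsLocalization.Away.invSelf c) = (algebraMap φ.range _ c)⁻¹ := by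
    have h1 : ψ (algebraMap φ.range (Localization.Away c) c) *
        ψ (IsLocalization.Away.invSelf c) = 1 := by
      rw [← map_mul, IsLocalization.Away.mul_invSelf, map_one]
    rw [AlgHom.commutes] at h1
    exact eq_inv_of_mul_eq_one_right h1
  -- `ψ (x / c) = β` in `K` when `x = c β` in `k[s, w]`
  have hψgen : ∀ (x : φ.range) (β : MvPolynomial (Fin 2) k),
      (x : MvPolynomial (Fin 2) k) = (X 0 ^ 3 - X 0 ^ 2 * X 1) * β →
      ψ (algebraMap φ.range (Localization.Away c) x * IsLocalization.Away.invSelf c) =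
        algebraMap (MvPolynomial (Fin 2) k) (FractionRing (MvPolynomial (Fin 2) k)) β := by
    intro x β hβ
    rw [map_mul ψ, AlgHom.commutes, hψc, hRK, hRK, hβ, hcB, map_mul, mul_comm, ← mul_assoc,
      inv_mul_cancel₀ hcK, one_mul]
  -- the image of the generators `x / c`, `x ∈ I`, generates `k[s, w]`
  have himage : Algebra.adjoin φ.range (ψ '' blowupAlgebraGens I c) =
      (IsScalarTower.toAlgHom φ.range (MvPolynomial (Fin 2) k) (FractionRing (MvPolynomial (Fin 2) k))).range := by
    apply le_antisymm
    · refine Algebra.adjoin_le ?_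
      rintro _ ⟨_, ⟨x, hx, rfl⟩, rfl⟩
      obtain ⟨β, hβ⟩ := (hmem x).mp hx
      exact ⟨β, (hψgen x β hβ).symm⟩
    · rintro _ ⟨β, rfl⟩
      change algebraMap (MvPolynomial (Fin 2) k) (FractionRing (MvPolynomial (Fin 2) k)) β ∈ _
      obtain ⟨ρ₀, hρ₀, ρ₁, hρ₁, rfl⟩ := exists_add_X_mul_of_range φ hφ β
      -- `s = (c s)/c` is the image of a generator
      have hsK : algebraMap (MvPolynomial (Fin 2) k) (FractionRing (MvPolynomial (Fin 2) k)) (X 0) ∈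
          Algebra.adjoin φ.range (ψ '' blowupAlgebraGens I c) := by
        refine Algebra.subset_adjoin ⟨_, ⟨_, hcs, rfl⟩, ?_⟩
        exact hψgen _ (X 0) (by rw [coe_rangeRestrict_apply, has])
      have h0 : algebraMap (MvPolynomial (Fin 2) k) (FractionRing (MvPolynomial (Fin 2) k)) ρ₀ ∈
          Algebra.adjoin φ.range (ψ '' blowupAlgebraGens I c) := by
        rw [← hRK ⟨ρ₀, hρ₀⟩]
        exact Subalgebra.algebraMap_mem _ _
      have h1 : algebraMap (MvPolynomial (Fin 2) k) (FractionRing (MvPolynomial (Fin 2) k)) ρ₁ ∈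
          Algebra.adjoin φ.range (ψ '' blowupAlgebraGens I c) := by
        rw [← hRK ⟨ρ₁, hρ₁⟩]
        exact Subalgebra.algebraMap_mem _ _
      rw [map_add, map_mul]
      exact Subalgebra.add_mem _ h0 (Subalgebra.mul_mem _ hsK h1)
  have heq : (blowupAlgebra I c).map ψ =
      (IsScalarTower.toAlgHom φ.range (MvPolynomial (Fin 2) k) (FractionRing (MvPolynomial (Fin 2) k))).range := by
    rw [blowupAlgebra, AlgHom.map_adjoin, himage]
  let Bimg : Subalgebra φ.range (FractionRing (MvPolynomial (Fin 2) k)) :=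
    (IsScalarTower.toAlgHom φ.range (MvPolynomial (Fin 2) k) (FractionRing (MvPolynomial (Fin 2) k))).range
  have heq' : (blowupAlgebra I c).map ψ = Bimg := heq
  let e₂a : ↥(blowupAlgebra I c) ≃ₐ[φ.range] ↥((blowupAlgebra I c).map ψ) :=
    (blowupAlgebra I c).equivMapOfInjective ψ hψinj
  let e₂b : ↥((blowupAlgebra I c).map ψ) ≃ₐ[φ.range] ↥Bimg :=
    Subalgebra.equivOfEq ((blowupAlgebra I c).map ψ) Bimg heq'
  let e₂ : blowupAlgebra I c ≃ₐ[φ.range] Bimg := e₂a.trans e₂b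
  let e₃ : MvPolynomial (Fin 2) k ≃ₐ[φ.range] Bimg := AlgEquiv.ofInjective
    (IsScalarTower.toAlgHom φ.range (MvPolynomial (Fin 2) k) (FractionRing (MvPolynomial (Fin 2) k))) hinjBK
  let eA : blowupAlgebra I c ≃ₐ[φ.range] MvPolynomial (Fin 2) k := e₂.trans e₃.symm
  let e₁ : Away (reesGrading I) (reesT c hcI) ≃ₐ[φ.range] blowupAlgebra I c :=
    AlgEquiv.ofRingEquiv (f := reesChartEquiv c hcI) (fun x => reesChartEquiv_reesChartBase c hcI x)
  exact ⟨e₁.trans eA⟩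

open CategoryTheory AlgebraicGeometry Literature.AlgebraicGeometry.Resolution HomogeneousLocalization in
/-- **J2 — `junction_cusp_resolves`.** For the cuspidal cylinder `H = {v² = u³} × 𝔸¹_w =
Spec k[s², s³, w]` with singular line `Σ = {u = v = 0}` and the in-`H` companion `R = {u = w², v = w³}`
through the origin, the blowing up of `H` along `X = Σ ∪ R` (i.e. along the trace ideal
`I = I_X · 𝒪_H = (s³ − s²w, s⁴ − s²w²)`) IS the normalisation `𝔸²_{s,w} = Spec k[s, w] → H`: there is an
isomorphism `Bl_I(H) ≅ 𝔸²` over `H`. In particular `Bl_X H` is regular — the single-sheet cuspidal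
junction is RESOLVED in one step (as is `Bl_Σ H`): no damage. [OURS · L1 W4.5b · CRUX-PLAN v3 §1.6 (J2);
helper for `stub_elnat_three` of crux `EquisingularLiftNat` stmt-ResolutionOfSingularities-20038; NOT a
statement of any manuscript] [folklore] -/
theorem junction_cusp_resolves (φ : MvPolynomial (Fin 3) k →ₐ[k] MvPolynomial (Fin 2) k)
    (hφ : φ = aeval ![X 0 ^ 2, X 0 ^ 3, X 1]) (I : Ideal φ.range)
    (hI : I = Ideal.span {φ.rangeRestrict (X 1 - X 0 * X 2), φ.rangeRestrict (X 0 * (X 0 - X 2 ^ 2))}) :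
    ∃ e : affineBlowup I ≅ Spec (.of (MvPolynomial (Fin 2) k)),
      e.hom ≫ Spec.map (CommRingCat.ofHom φ.range.val.toRingHom) = affineBlowup.π I := by
  have hsq := traceIdeal_sq φ hφ I hI
  obtain ⟨c, hc⟩ : ∃ c : φ.range, c = φ.rangeRestrict (X 1 - X 0 * X 2) := ⟨_, rfl⟩
  have hgI : c ∈ I := by rw [hI, hc]; exact Ideal.subset_span (by simp)
  rw [← hc] at hsq
  letI := (reesChartBase (I := I) c hgI).toAlgebra
  obtain ⟨eA⟩ := nonempty_algEquiv_away_traceIdeal φ hφ I hI c hc hgI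
  haveI := isIso_chartι_of_basicOpen_eq_top c hgI (basicOpen_reesT_eq_top_of_sq c hgI hsq)
  -- `Spec k[s,w] ≅ Spec (R[It])_{(ct)} ≅ Bl_I(Spec R)`
  let e₁ : Spec (.of (MvPolynomial (Fin 2) k)) ≅ Spec (.of (Away (reesGrading I) (reesT c hgI))) :=
    Scheme.Spec.mapIso eA.toRingEquiv.toCommRingCatIso.op
  let e₂ : Spec (.of (Away (reesGrading I) (reesT c hgI))) ≅ affineBlowup I :=
    asIso (affineBlowup.chartι (I := I) c hgI)
  have h1 : e₁.inv = Spec.map (CommRingCat.ofHom (eA.symm.toRingEquiv.toRingHom)) := rfl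
  have h2 : e₂.inv = inv (affineBlowup.chartι (I := I) c hgI) := rfl
  refine ⟨(e₁ ≪≫ e₂).symm, ?_⟩
  rw [Iso.symm_hom, Iso.trans_inv, Category.assoc, h2, IsIso.inv_comp_eq,
    affineBlowup.chartι_π, h1, ← Spec.map_comp]
  congr 1
  apply CommRingCat.hom_ext
  apply RingHom.ext
  intro x
  change eA.symm (algebraMap φ.range (MvPolynomial (Fin 2) k) x) = reesChartBase c hgI x
  exact eA.symm.commutes x

end CuspModel

end Summit.ResolutionOfSingularities.ResolutionOfSingularities.Theorems.EquisingularLift.Junction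

end
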